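import Literature.AlgebraicGeometry.Modules.RankOneCocycle
import HarnessLib

/-!
# Frames differing by SCALARS: the determinant class is the `n`-th power of the scalar cocycle

Layer `Literature/AlgebraicGeometry/Modules`, namespace `Literature.AlgebraicGeometry.Modules`.  THEOREMS ONLY (no definition, no
named fact, no instance, no notation, no `sorry`).  Cell `hodgecm-mathlib` (D-0151), floor-0 programme P1, sub-line F-13 (`stub_PL`),
inner target P3 «unit cocycle of a linear rigidification», socket (S1) / (c1) «`(m+1)[U] = [det π_*L^{Δ3}]`» — this file is its
generic half: frames of a module on a point-indexed cover that differ by scalar units `g_{xy}` have determinant cocycle `g_{xy}^n`.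
Count-neutral capital: HC_CM is proved only modulo the 7 printed citations until rung 0 closes — nothing here bears on a summit
statement.

[Hartshorne1977] II Ex. 5.16 (d)/(e), Ex. 6.11: the determinant line bundle `det E = Λⁿ E` of a locally free `E` of rank `n` with
transition matrices `T_{xy}` has transition functions `det T_{xy}`; if `T_{xy} = g_{xy} · 1` is SCALAR then `det T_{xy} = g_{xy}^n`,
i.e. `[det E] = [g]^n` in `Pic X = Ȟ¹(X, 𝒪_X^×)` (III Ex. 4.5).  This is the situation of [MumfordFogartyKirwan1994] Prop. 7.4 / Def. 7.5
(p. 130/135): the local frames of `π_*(L^{Δ3})` given by a linear rigidification differ on overlaps by units of the base, and the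
resulting class `[U]` satisfies `(m+1)[U] = [det π_*L^{Δ3}]`.  In the tree's currency (★ `Modules/UnitCocycle`: point-indexed unit
cocycles `c = (U_x, g_{xy})`, ★ `CechPic`; ★ `Modules/FrameTransition`: `transition`, `transitionDet`; ★ `Modules/DeterminantCocycle`:
`FrameSystem`, `detClass`, `detClass_eq_mk`): for frames `e_x : 𝒪^I ≅ E|_{U_x}` on the opens of `c` with
`b^{(y)}_i|_V = g_{xy}|_V • b^{(x)}_i|_V` for all `i` (the convention of ★ `UnitCocycle.lineBundleFrameSystem_cocycle_g`: `t_w = g_{zw} t_z`),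

* §1 `transition_eq_smul_one_of_basisSection_eq_smul` — the transition matrix `T(e_x, e_y)` over `V` is `g_{xy} • 1`;
  `transitionDet_eq_pow_of_basisSection_eq_smul` — its determinant is `g_{xy}^n` (`n = #I`; Mathlib `Matrix.det_smul`).
* §2 `hasRank_of_framesOnCocycleCover` — `E` has rank `n` (local freeness itself is ★ `FrameSystem.isFiniteLocallyFree`);
  **`detClass_eq_mk_pow_of_basisSection_eq_smul`** — `detClass E = (CechPic.mk c)^n` (any local-freeness witness, ★ `detClass_congr`).

## References
* [Hartshorne1977] R. Hartshorne, *Algebraic Geometry* (1977), II Ex. 5.16 (d), (e) (p. 127); II Ex. 6.11; III Ex. 4.5.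
* [MumfordFogartyKirwan1994] D. Mumford, J. Fogarty, F. Kirwan, *Geometric Invariant Theory*, 3rd ed. (1994), Ch. 7 §2 Def. 7.5
  (p. 130), Prop. 7.4 (p. 135) — the consumer, not used in the proofs.
-/

noncomputable section

-- `TopCat.Presheaf`/`Scheme.Modules` are not reducible (as in Mathlib's `AlgebraicGeometry/Modules/Sheaf.lean`).
set_option backward.isDefEq.respectTransparency false

universe u

open CategoryTheory AlgebraicGeometry TopologicalSpace Opposite
open Literature.AlgebraicGeometry.Motives

namespace Literature.AlgebraicGeometry.Modules

variable {X : Scheme.{u}} {E : X.Modules} {I : Type u} {n : ℕ} (ε : I ≃ Fin n)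
  (c : UnitCocycle X) (e : ∀ x, SheafOfModules.free I ≅ E.over (c.U x))
  (he : ∀ (x y : X) (V : X.Opens) (hx : V ≤ c.U x) (hy : V ≤ c.U y) (i : I),
    E.presheaf.map (homOfLE hy).op (basisSection (e y) i) =
      c.g x y V hx hy • E.presheaf.map (homOfLE hx).op (basisSection (e x) i))

/-! ## §1 Scalar transition matrices and their determinants -/

include he in
/-- **Frames differing by a scalar have the scalar transition matrix**: if `b^{(y)}_i|_V = g_{xy} • b^{(x)}_i|_V` for all `i`, the
transition matrix `T(e_x, e_y)` over `V` (★ `transition`: coordinates in `e_x` of the basis sections of `e_y`) is `g_{xy} • 1`.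
[cite: Hartshorne1977, II Ex. 5.16] -/
theorem transition_eq_smul_one_of_basisSection_eq_smul [DecidableEq I] (x y : X) (V : X.Opens) (hx : V ≤ c.U x)
    (hy : V ≤ c.U y) :
    transition (e x) (e y) (homOfLE hx) (homOfLE hy) = c.g x y V hx hy • (1 : Matrix I I Γ(X, V)) := by
  ext i j
  rw [transition_apply, he x y V hx hy j, coord_smul, coord_map_basisSection, Matrix.smul_apply, Matrix.one_apply,
    smul_eq_mul]
  exact congrArg _ (if_congr eq_comm rfl rfl)

include he in
/-- **The determinant of a scalar transition matrix is the `n`-th power of the scalar** (`n = #I`): `det T(e_x, e_y) = g_{xy}^n` over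
every `V ≤ U_x ∩ U_y` (★ `transitionDet`; Mathlib `Matrix.det_smul`). [cite: Hartshorne1977, II Ex. 5.16] -/
theorem transitionDet_eq_pow_of_basisSection_eq_smul (x y : X) (V : X.Opens) (hx : V ≤ c.U x) (hy : V ≤ c.U y) :
    transitionDet (e x) (e y) ε ε (homOfLE hx) (homOfLE hy) = c.g x y V hx hy ^ n := by
  classical
  have hstd : stdTransition (e x) (e y) ε ε (homOfLE hx) (homOfLE hy) =
      c.g x y V hx hy • (1 : Matrix (Fin n) (Fin n) Γ(X, V)) := by
    ext a b
    simp only [stdTransition_apply, transition_eq_smul_one_of_basisSection_eq_smul c e he x y V hx hy, Matrix.smul_apply,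
      Matrix.one_apply, EmbeddingLike.apply_eq_iff_eq]
  rw [transitionDet_eq, hstd, Matrix.det_smul, Matrix.det_one, mul_one, Fintype.card_fin]

/-! ## §2 Local freeness, rank, and the determinant class -/

include ε c e in
/-- A module with frames `𝒪^I ≅ E|_{U_x}`, `I ≃ Fin n`, on a point-indexed cover has rank `n` (★ `FrameSystem.hasRank`).
[cite: Hartshorne1977, II Ex. 5.16] -/
theorem hasRank_of_framesOnCocycleCover : HasRank E n :=
  FrameSystem.hasRank { U := c.U, mem := c.mem, I := fun _ => I, rank := fun _ => n, enum := fun _ => ε, frame := e } n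
    fun _ => rfl

include ε he in
/-- **`[det E] = [g]^n` for frames differing by scalars.**  If `E` has frames `e_x : 𝒪^I ≅ E|_{U_x}` (`I ≃ Fin n`) on the opens of a
unit cocycle `c = (U_x, g_{xy})` with `b^{(y)}_i|_V = g_{xy}|_V • b^{(x)}_i|_V` for all `i` and all `V ≤ U_x ∩ U_y`, then the
determinant class of `E` (★ `detClass`, any local-freeness witness) is `(CechPic.mk c)^n` in `Ȟ¹(X, 𝒪_X^×)`: the frame system
`(U_x, e_x)` has determinant cocycle `det T(e_x, e_y) = g_{xy}^n` (§1), and `[gⁿ] = [g]^n` (★ `CechPic.mk_mul`).  [Hartshorne1977]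
II Ex. 6.11 / III Ex. 4.5; the shape of [MumfordFogartyKirwan1994] Prop. 7.4's `(m+1)[U] = [det π_*L^{Δ3}]`.
[cite: Hartshorne1977, II Ex. 5.16] [cite: Hartshorne1977, III Ex. 4.5] -/
theorem detClass_eq_mk_pow_of_basisSection_eq_smul (hE : IsFiniteLocallyFree E) : detClass hE = (CechPic.mk c) ^ n := by
  let F : FrameSystem E :=
    { U := c.U, mem := c.mem, I := fun _ => I, rank := fun _ => n, enum := fun _ => ε, frame := e }
  have hFg : ∀ (x y : X) (V : X.Opens) (hx : V ≤ c.U x) (hy : V ≤ c.U y),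
      F.cocycle.g x y V hx hy = c.g x y V hx hy ^ n :=
    fun x y V hx hy => transitionDet_eq_pow_of_basisSection_eq_smul ε c e he x y V hx hy
  -- the `m`-th powers of `c`, as cocycles, and their classes
  let cpow : ℕ → UnitCocycle X := fun m =>
    { U := c.U
      mem := c.mem
      g := fun x y V hx hy => c.g x y V hx hy ^ m
      map_g := fun x y V V' hx hy i => by
        change X.presheaf.map (homOfLE i).op (c.g x y V hx hy ^ m) = _
        rw [map_pow]
        exact congrArg (· ^ m) (c.map_g x y hx hy i)
      g_mul := fun x y z V hx hy hz => by rw [← mul_pow, c.g_mul]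
      g_self := fun x V hx => by rw [c.g_self, one_pow] }
  have hc : ∀ m : ℕ, CechPic.mk (cpow m) = (CechPic.mk c) ^ m := by
    intro m
    induction m with
    | zero =>
      rw [pow_zero, ← CechPic.mk_one]
      exact CechPic.sound (UnitCocycle.equiv_of_eq _ _ c.U c.mem (fun _ => le_rfl) (fun _ => le_top)
        fun x y V hx hy => by change (1 : Γ(X, V)) = c.g x y V _ _ ^ 0; rw [pow_zero])
    | succ m ih =>
      rw [pow_succ, ← ih, ← CechPic.mk_mul]
      refine CechPic.sound (UnitCocycle.equiv_of_eq _ _ c.U c.mem (fun _ => le_rfl) (fun _ => le_inf le_rfl le_rfl) ?_)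
      intro x y V hx hy
      change c.g x y V _ _ ^ m * c.g x y V _ _ = c.g x y V _ _ ^ (m + 1)
      rw [pow_succ]
  rw [detClass_eq_mk hE F, ← hc n]
  exact CechPic.sound (UnitCocycle.equiv_of_eq _ _ c.U c.mem (fun _ => le_rfl) (fun _ => le_rfl)
    fun x y V hx hy => (hFg x y V hx hy).symm)

end Literature.AlgebraicGeometry.Modules

end
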